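import Summits.BirchSwinnertonDyer.BirchSwinnertonDyer.Theorems.ByReductionTypeAtTwoRankOneAtTwoOffBigImageOddLocalImageCellDefs
import Summits.BirchSwinnertonDyer.BirchSwinnertonDyer.Theorems.GenusKolyvaginAtTwoShaCardDvdPowAtTwoRSquareAllowance
import Summits.BirchSwinnertonDyer.BirchSwinnertonDyer.Theorems.GenusKolyvaginAtTwoCasselsTateTotallyComplex
import HarnessLib

/-!
# Route `ByReductionTypeAtTwo`, crux `RankOneAtTwoOffBigImageOddLocal` (stmt-BirchSwinnertonDyer-23716), line
# `refined_kolyvagin_tamagawa_shift_at_two`, stub `stub_sigmaShiftPosDisc`: the FIRST RUNG of the Kolyvagin–McCallum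
# ladder at `p = 2` — where the bit goes, and ONE BIT IS FREE IN EACH DIRECTION (unconditionally over the Heegner field)

Lead prover `prover-cruxlead-stmt-BirchSwinnertonDyer-23716-g6` (2026-08-28), `--supports stmt-BirchSwinnertonDyer-23716`
(helper; closes nothing).  THEOREMS ONLY (no definition, no named fact, no `sorry`).  Companion memo
`Cruxes/RankOneAtTwoOffBigImageOddLocal/FirstRungAtTwo.md`.

The lead's stub `ShiftedKolyvaginStructureModTwoWithOnPos ⊤ OnDeltaPlusCell` is McCallum's structure theorem
«`#Ш(E/K)[p^∞] = p^{2(M₀ − M_∞)}`» (LMS 153, Thm. 5.4) read at `p = 2` with `M_∞ = σ ≥ 1` on {full `2`-adic image, `Δ > 0`}.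
McCallum's first rung «`M₁ = M₀`» uses, at odd `p`, that the (−ε)-eigenspace of complex conjugation on the rank-one line
`E(K) ⊗ ℤ_p = ℤ_p·g` (`τ g = ε g`) reduced mod `p^M` is ZERO, so that the class `p^{M−M₀}·c_M(ℓ) ∈ Sel^{−ε}` vanishes.  §1
records the `p = 2` replacement in kernel form: on ANY abelian group on which an involution acts as the scalar `ε = ±1`, the
opposite eigenspace `{x : τ x = −ε x}` is EXACTLY the `2`-torsion `{x : 2x = 0}` (`oppositeEigen_iff_two_nsmul_eq_zero`) — on
`E(K)/2^M ≅ ℤ/2^M` the two-element group `{0, η}`, `η = [2^{M−1} g]`, not `0`; it vanishes as soon as the group has no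
`2`-torsion (`oppositeEigen_eq_zero_of_two_nsmul_injective`, the odd-`p` case).  Likewise a Galois-invariant pairing of classes of
OPPOSITE signs is `2`-TORSION, not zero (`two_nsmul_pairing_eq_zero_of_opposite_signs`): the local Tate pairing of
`H¹_f(K_λ)^{±}` against `H¹_s(K_λ)^{∓}` at a Kolyvagin prime keeps one bit at `2`.  These two facts are the whole of the
«eigenspace decomposition fails at 2» entry of the sibling route's 22137 docstring, located at the first rung; the memo shows
that the bit is DECIDED (no loss) at every Kolyvagin prime that is Čebotarev-generic for `y_K` and at every level `M > M₀`, and is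
formally undetermined only at boundary level `M(ℓ) ≤ M₀` at primes where `y_K/2^{M₀}` is a local square — which on `Δ > 0` is
EVERY prime whose Frobenius is complex conjugation (the engine's regular primes are the generic ones).

§2–§3: whatever road proves the two halves of the stub, ONE bit in each direction costs nothing.  The `2`-primary part of
`Ш(E_K/K)` has square order once finite, by the Cassels–Tate pairing — a KERNEL THEOREM over the (totally complex) Heegner field
(`GenusExact.CasselsTateTotallyComplex.exists_casselsTate_pairing_of_isTotallyComplex`, seat gk2-p1, with gk2-p3's
`isSquare_natCard_primaryComponent_sha_of_casselsTate`) — so `#Ш[2^∞] ∣ 2^{2k+1}` gives `∣ 2^{2k}` (the sibling's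
`natCard_sha_dvd_pow_of_dvd_pow_succ`, typed there for the upper half U = 28029) AND `2^{2k−1} ∣ #Ш[2^∞] ≠ 0` gives `2^{2k} ∣`
(`pow_two_mul_dvd_of_isSquare_of_pow_pred_dvd`, new: the lower direction); together `natCard_sha_two_eq_pow_of_allowance`:
the EXACT count from the two one-bit-slack halves, unconditionally.  §3 `shiftedStructureWithOnPos_of_halves_allowance`: the
registered stub statement `ShiftedKolyvaginStructureModTwoWithOnPos Φ Ω` (every filter, every cell; the registered instance is
`Φ = ⊤`, `Ω = OnDeltaPlusCell`) follows from its UPPER half with conclusion `#Ш(E/K)[2^∞] ∣ 2^{2(M₀−σ)+1}` and its LOWER half with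
conclusion `2^{2(M₀−σ)−1} ∣ #Ш(E/K)[2^∞]`, binders VERBATIM otherwise.  Two or more bits in one direction do not come back this
way.  BSD is not proved by any of this; the stub, the crux and the summit stay OPEN.

References: [McCallumLMS1991] §5, Prop. 5.2, Thm. 5.4; [GrossLMS1991] Prop. 5.4 (ii), Prop. 6.2; [KolyvaginEulerSystems1990]
Thm. A; [Cassels1962ArithmeticIV]; [SilvermanAEC2009] Thm. X.4.14; [MilneADT2006] I Thm. 6.13 (a).
-/

set_option linter.dupNamespace false -- tree convention: `Summit.BirchSwinnertonDyer.BirchSwinnertonDyer.Theorems` (summit = sub-problem)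
set_option autoImplicit false

noncomputable section

open scoped Classical

namespace Summit.BirchSwinnertonDyer.BirchSwinnertonDyer.Theorems.OffBigImageOddLocalAtTwo.FirstRung

open WeierstrassCurve NumberField Literature.NumberTheory.EllipticCurves
  Literature.NumberTheory.EllipticCurves.ModularForms
  Summit.BirchSwinnertonDyer.BirchSwinnertonDyer.Theorems.GenusExact.VisiblePairAtTwo
  Summit.BirchSwinnertonDyer.BirchSwinnertonDyer.Theorems.GenusExact.CasselsTateTotallyComplex

/-! ## §1 The first-rung algebra at `2`: opposite eigenspaces and opposite-sign pairings are `2`-torsion, not zero -/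

/-- **The scalar `ε = ±1` and its negative agree exactly on the `2`-torsion**: `ε x = −ε x ↔ 2x = 0`. [folklore] -/
theorem smul_eq_neg_smul_iff_two_nsmul_eq_zero {A : Type*} [AddCommGroup A] {ε : ℤ} (hε : ε = 1 ∨ ε = -1) (x : A) :
    ε • x = -(ε • x) ↔ 2 • x = 0 := by
  rcases hε with rfl | rfl
  · rw [one_smul, eq_neg_iff_add_eq_zero, two_nsmul]
  · rw [neg_smul, one_smul, neg_neg, neg_eq_iff_add_eq_zero, two_nsmul]

/-- **The located bit of McCallum's first rung at `p = 2`.**  If an endomorphism `τ` (complex conjugation) acts on an abelian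
group `A` (the Mordell–Weil line `E(K)/2^M`, or any `τ`-isotypic group) as the scalar `ε = ±1`, then the OPPOSITE eigenspace
`{x : τ x = −ε x}` is exactly the `2`-torsion of `A` — on `ℤ/2^M` the two-element group `{0, 2^{M−1}}`, where at odd `p` it is
`0` (McCallum's step «`p^{M−M₀} c_M(ℓ) ∈ Sel(E/K)^{−ε} = 0`», Thm. 5.4, first rung).
[cite: McCallumLMS1991, §5 Thm. 5.4] [cite: GrossLMS1991, Prop. 5.4 (ii)] -/
theorem oppositeEigen_iff_two_nsmul_eq_zero {A : Type*} [AddCommGroup A] (τ : A →+ A) {ε : ℤ} (hε : ε = 1 ∨ ε = -1)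
    (hτ : ∀ x, τ x = ε • x) (x : A) : τ x = -(ε • x) ↔ 2 • x = 0 := by
  rw [hτ]
  exact smul_eq_neg_smul_iff_two_nsmul_eq_zero hε x

/-- **The odd-`p` shape of the same step**: if `A` has no `2`-torsion (e.g. a `ℤ/p^M`-module, `p` odd), the opposite
eigenspace of a scalar involution is `0`. [cite: McCallumLMS1991, §5 Thm. 5.4] -/
theorem oppositeEigen_eq_zero_of_two_nsmul_injective {A : Type*} [AddCommGroup A] (τ : A →+ A) {ε : ℤ}
    (hε : ε = 1 ∨ ε = -1) (hτ : ∀ x, τ x = ε • x) (h2 : ∀ x : A, 2 • x = 0 → x = 0) {x : A}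
    (hx : τ x = -(ε • x)) : x = 0 :=
  h2 x ((oppositeEigen_iff_two_nsmul_eq_zero τ hε hτ x).mp hx)

/-- Conversely every `2`-torsion element lies in BOTH eigenspaces of a scalar involution (at `2` the `±`-eigenspaces of
`E(K)/2^M` meet in `{0, η}`). [folklore] -/
theorem mem_bothEigen_of_two_nsmul_eq_zero {A : Type*} [AddCommGroup A] (τ : A →+ A) {ε : ℤ} (hε : ε = 1 ∨ ε = -1)
    (hτ : ∀ x, τ x = ε • x) {x : A} (hx : 2 • x = 0) : τ x = ε • x ∧ τ x = -(ε • x) :=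
  ⟨hτ x, (oppositeEigen_iff_two_nsmul_eq_zero τ hε hτ x).mpr hx⟩

/-- **Opposite-sign pairings are `2`-torsion, not zero.**  For a bi-additive pairing `P` invariant under a pair of
endomorphisms (`P (τa) (τ'b) = P a b`: the local Tate pairing at a Kolyvagin prime is `Gal(K_λ/ℚ_ℓ)`-invariant, the
invariant map being fixed), a `τ = ε` vector pairs with a `τ' = −ε` vector into the `2`-TORSION of the value group: `2·P a b = 0`.
At odd `p` (value group `ℤ/p^M`) this is McCallum's «`H¹_f(K_λ)^{±}` is orthogonal to `H¹_s(K_λ)^{±}`» (Prop. 5.2 / Lemma 5.3);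
at `2` one bit of `ℤ/2^M` survives. [cite: McCallumLMS1991, §5 Prop. 5.2] -/
theorem two_nsmul_pairing_eq_zero_of_opposite_signs {A B C : Type*} [AddCommGroup A] [AddCommGroup B] [AddCommGroup C]
    (P : A →+ B →+ C) (τA : A →+ A) (τB : B →+ B) (hP : ∀ a b, P (τA a) (τB b) = P a b) {ε : ℤ}
    (hε : ε = 1 ∨ ε = -1) {a : A} {b : B} (ha : τA a = ε • a) (hb : τB b = -(ε • b)) : 2 • P a b = 0 := by
  have h := hP a b
  rcases hε with rfl | rfl
  · rw [one_smul] at ha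
    rw [one_smul] at hb
    rw [ha, hb, map_neg] at h
    -- `h : -(P a b) = P a b`
    rw [two_nsmul]
    exact neg_eq_iff_add_eq_zero.mp h
  · rw [neg_smul, one_smul] at ha
    rw [neg_smul, one_smul, neg_neg] at hb
    rw [ha, hb, map_neg, AddMonoidHom.neg_apply] at h
    rw [two_nsmul]
    exact neg_eq_iff_add_eq_zero.mp h

/-- The same with the signs the other way round (`τ = −ε` against `τ' = ε`). [cite: McCallumLMS1991, §5 Prop. 5.2] -/
theorem two_nsmul_pairing_eq_zero_of_opposite_signs' {A B C : Type*} [AddCommGroup A] [AddCommGroup B] [AddCommGroup C]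
    (P : A →+ B →+ C) (τA : A →+ A) (τB : B →+ B) (hP : ∀ a b, P (τA a) (τB b) = P a b) {ε : ℤ}
    (hε : ε = 1 ∨ ε = -1) {a : A} {b : B} (ha : τA a = -(ε • a)) (hb : τB b = ε • b) : 2 • P a b = 0 := by
  have hε' : -ε = 1 ∨ -ε = -1 := by rcases hε with rfl | rfl <;> simp
  refine two_nsmul_pairing_eq_zero_of_opposite_signs P τA τB hP hε' (a := a) (b := b) ?_ ?_
  · rw [neg_smul]; exact ha
  · rw [neg_smul, neg_neg]; exact hb

/-! ## §2 One bit is free in EACH direction: square order of `Ш[2^∞]` (Cassels–Tate, a theorem over the Heegner field) -/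

/-- **A nonzero square divisible by `p^{2k−1}` is divisible by `p^{2k}`** (`v_p` of a square is even). [folklore] -/
theorem pow_two_mul_dvd_of_isSquare_of_pow_pred_dvd {p : ℕ} (hp : p.Prime) {n k : ℕ} (hn : IsSquare n) (hn0 : n ≠ 0)
    (h : p ^ (2 * k - 1) ∣ n) : p ^ (2 * k) ∣ n := by
  haveI : Fact p.Prime := ⟨hp⟩
  obtain ⟨s, rfl⟩ := hn
  have hs0 : s ≠ 0 := by
    rintro rfl
    exact hn0 (mul_zero 0)
  rw [padicValNat_dvd_iff_le (mul_ne_zero hs0 hs0), padicValNat.mul hs0 hs0] at h ⊢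
  omega

/-- **Pointwise, LOWER direction at `2`**: over a totally complex number field `K` (the Heegner field is imaginary quadratic),
`2^{2k−1} ∣ #Ш(E/K)[2^∞] ≠ 0` gives `2^{2k} ∣ #Ш(E/K)[2^∞]` — UNCONDITIONALLY, the Cassels–Tate pairing over `K` being the
kernel theorem `exists_casselsTate_pairing_of_isTotallyComplex`. [cite: SilvermanAEC2009, Thm. X.4.14] [cite: Cassels1962ArithmeticIV] -/
theorem pow_dvd_natCard_sha_two_of_pow_pred_dvd {K : Type} [Field K] [NumberField K] [IsTotallyComplex K]
    (V : WeierstrassCurve K) [V.IsElliptic] {k : ℕ}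
    (h0 : Nat.card (AddCommGroup.primaryComponent V.sha 2) ≠ 0)
    (h : 2 ^ (2 * k - 1) ∣ Nat.card (AddCommGroup.primaryComponent V.sha 2)) :
    2 ^ (2 * k) ∣ Nat.card (AddCommGroup.primaryComponent V.sha 2) := by
  haveI : Fact (Nat.Prime 2) := ⟨Nat.prime_two⟩
  haveI : Finite (AddCommGroup.primaryComponent V.sha 2) := Nat.finite_of_card_ne_zero h0
  exact pow_two_mul_dvd_of_isSquare_of_pow_pred_dvd Nat.prime_two
    (isSquare_natCard_primaryComponent_sha_of_casselsTate V 2 (exists_casselsTate_pairing_of_isTotallyComplex (K := K)))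
    h0 h

/-- **Pointwise, UPPER direction at `2`, unconditional over a totally complex field** (the sibling's
`natCard_sha_dvd_pow_of_dvd_pow_succ` with its Cassels–Tate hypothesis DISCHARGED). [cite: SilvermanAEC2009, Thm. X.4.14] -/
theorem natCard_sha_two_dvd_pow_of_dvd_pow_succ {K : Type} [Field K] [NumberField K] [IsTotallyComplex K]
    (V : WeierstrassCurve K) [V.IsElliptic] {k : ℕ}
    (h : Nat.card (AddCommGroup.primaryComponent V.sha 2) ∣ 2 ^ (2 * k + 1)) :
    Nat.card (AddCommGroup.primaryComponent V.sha 2) ∣ 2 ^ (2 * k) :=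
  natCard_sha_dvd_pow_of_dvd_pow_succ (exists_casselsTate_pairing_of_isTotallyComplex (K := K)) V h

/-- **The EXACT count from two one-bit-slack halves**: over a totally complex `K`, `#Ш(E/K)[2^∞] ∣ 2^{2k+1}` and
`2^{2k−1} ∣ #Ш(E/K)[2^∞]` together give `#Ш(E/K)[2^∞] = 2^{2k}` (finiteness comes from the upper half).  Unconditional.
[cite: SilvermanAEC2009, Thm. X.4.14] [cite: McCallumLMS1991, §5 Thm. 5.4] -/
theorem natCard_sha_two_eq_pow_of_allowance {K : Type} [Field K] [NumberField K] [IsTotallyComplex K]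
    (V : WeierstrassCurve K) [V.IsElliptic] {k : ℕ}
    (hU : Nat.card (AddCommGroup.primaryComponent V.sha 2) ∣ 2 ^ (2 * k + 1))
    (hL : 2 ^ (2 * k - 1) ∣ Nat.card (AddCommGroup.primaryComponent V.sha 2)) :
    Nat.card (AddCommGroup.primaryComponent V.sha 2) = 2 ^ (2 * k) := by
  have h0 : Nat.card (AddCommGroup.primaryComponent V.sha 2) ≠ 0 := fun h0 ↦ by
    rw [h0] at hU
    exact (pow_ne_zero _ two_ne_zero) (zero_dvd_iff.mp hU)
  exact Nat.dvd_antisymm (natCard_sha_two_dvd_pow_of_dvd_pow_succ V hU) (pow_dvd_natCard_sha_two_of_pow_pred_dvd V h0 hL)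

/-! ## §3 The lead's stub from its two halves, each with one free bit -/

/-- **`ShiftedKolyvaginStructureModTwoWithOnPos Φ Ω` follows from its two halves with ONE FREE BIT each** — the UPPER half
`hU` (binders of the stub VERBATIM, conclusion `#Ш(E/K)[2^∞] ∣ 2^{2(M₀−σ)+1}`: an annihilation argument at `2` that loses one
bit in total) and the LOWER half `hL` (same binders, conclusion `2^{2(M₀−σ)−1} ∣ #Ш(E/K)[2^∞]`: an exhibition argument that
misses one bit), for EVERY witness filter `Φ` and EVERY cell `Ω`; the registered stub `stub_sigmaShiftPosDisc` is the instance
`Φ = ⊤`, `Ω = OnDeltaPlusCell`.  Unconditional: the square order of `Ш(E_K/K)[2^∞]` is a theorem over the imaginary quadratic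
(totally complex) `K`.  Conditional on nothing; proves neither half. [cite: McCallumLMS1991, §5 Thm. 5.4]
[cite: SilvermanAEC2009, Thm. X.4.14] -/
theorem shiftedStructureWithOnPos_of_halves_allowance (Φ : WeierstrassCurve ℚ → ℕ → Prop) (Ω : WeierstrassCurve ℚ → Prop)
    (hU : ∀ (W : WeierstrassCurve ℚ) [W.IsElliptic] [W.IsGloballyMinimal] [NeZero (W.conductorNorm ℤ)],
      ¬ W.HasCM → W.HasSurjectiveModNGaloisRep 2 → Ω W →
      ∀ (K : Type) [Field K] [NumberField K], IsImaginaryQuadratic K → Odd (NumberField.discr K) →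
        NumberField.discr K ≠ -3 → SatisfiesHeegnerHypothesis (W.conductorNorm ℤ) K →
        ¬ IsSquare ((NumberField.discr K : ℚ) * -|W.Δ|) → ¬ IsSquare ((NumberField.discr K : ℚ) * (-(2 * |W.Δ|))) →
        ∀ (Dt : ModularParametrizationData W (W.conductorNorm ℤ)) (β : ℤ) (ι : K →+* ℂ) (d₁ : KolyvaginHeegnerData Dt β ι 1),
          ¬ IsOfFinAddOrder d₁.derivedPoint → 0 < sigmaShift W Dt →
          ∀ (M₀ : ℕ), (∃ Q : (W.baseChange (ringClassField K ι 1)).toAffine.Point, ((2 ^ M₀ : ℕ) : ℤ) • Q = d₁.derivedPoint) →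
            (¬ ∃ Q : (W.baseChange (ringClassField K ι 1)).toAffine.Point, ((2 ^ (M₀ + 1) : ℕ) : ℤ) • Q = d₁.derivedPoint) →
            (∀ (n : ℕ) (d : KolyvaginHeegnerData Dt β ι n) (m : ℕ), Squarefree n →
                (∀ ℓ ∈ n.primeFactors, Zhang2014.IsKolyvaginPrime (W.conductorNorm ℤ) W K 2 ℓ) →
                (m : ℕ∞) ≤ Zhang2014.levelIndex W 2 n → m ≤ sigmaShift W Dt →
                ∃ Q : (W.baseChange (ringClassField K ι n)).toAffine.Point, ((2 ^ m : ℕ) : ℤ) • Q = d.derivedPoint) →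
            ∀ (n : ℕ) (d : KolyvaginHeegnerData Dt β ι n), Squarefree n →
              (∀ ℓ ∈ n.primeFactors, Zhang2014.IsKolyvaginPrime (W.conductorNorm ℤ) W K 2 ℓ ∧ Φ W ℓ) →
              ((sigmaShift W Dt + 1 : ℕ) : ℕ∞) ≤ Zhang2014.levelIndex W 2 n →
              (¬ ∃ Q : (W.baseChange (ringClassField K ι n)).toAffine.Point,
                ((2 ^ (sigmaShift W Dt + 1) : ℕ) : ℤ) • Q = d.derivedPoint) →
              Nat.card (AddCommGroup.primaryComponent (W.baseChange K).sha 2) ∣ 2 ^ (2 * (M₀ - sigmaShift W Dt) + 1))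
    (hL : ∀ (W : WeierstrassCurve ℚ) [W.IsElliptic] [W.IsGloballyMinimal] [NeZero (W.conductorNorm ℤ)],
      ¬ W.HasCM → W.HasSurjectiveModNGaloisRep 2 → Ω W →
      ∀ (K : Type) [Field K] [NumberField K], IsImaginaryQuadratic K → Odd (NumberField.discr K) →
        NumberField.discr K ≠ -3 → SatisfiesHeegnerHypothesis (W.conductorNorm ℤ) K →
        ¬ IsSquare ((NumberField.discr K : ℚ) * -|W.Δ|) → ¬ IsSquare ((NumberField.discr K : ℚ) * (-(2 * |W.Δ|))) →
        ∀ (Dt : ModularParametrizationData W (W.conductorNorm ℤ)) (β : ℤ) (ι : K →+* ℂ) (d₁ : KolyvaginHeegnerData Dt β ι 1),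
          ¬ IsOfFinAddOrder d₁.derivedPoint → 0 < sigmaShift W Dt →
          ∀ (M₀ : ℕ), (∃ Q : (W.baseChange (ringClassField K ι 1)).toAffine.Point, ((2 ^ M₀ : ℕ) : ℤ) • Q = d₁.derivedPoint) →
            (¬ ∃ Q : (W.baseChange (ringClassField K ι 1)).toAffine.Point, ((2 ^ (M₀ + 1) : ℕ) : ℤ) • Q = d₁.derivedPoint) →
            (∀ (n : ℕ) (d : KolyvaginHeegnerData Dt β ι n) (m : ℕ), Squarefree n →
                (∀ ℓ ∈ n.primeFactors, Zhang2014.IsKolyvaginPrime (W.conductorNorm ℤ) W K 2 ℓ) →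
                (m : ℕ∞) ≤ Zhang2014.levelIndex W 2 n → m ≤ sigmaShift W Dt →
                ∃ Q : (W.baseChange (ringClassField K ι n)).toAffine.Point, ((2 ^ m : ℕ) : ℤ) • Q = d.derivedPoint) →
            ∀ (n : ℕ) (d : KolyvaginHeegnerData Dt β ι n), Squarefree n →
              (∀ ℓ ∈ n.primeFactors, Zhang2014.IsKolyvaginPrime (W.conductorNorm ℤ) W K 2 ℓ ∧ Φ W ℓ) →
              ((sigmaShift W Dt + 1 : ℕ) : ℕ∞) ≤ Zhang2014.levelIndex W 2 n →
              (¬ ∃ Q : (W.baseChange (ringClassField K ι n)).toAffine.Point,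
                ((2 ^ (sigmaShift W Dt + 1) : ℕ) : ℤ) • Q = d.derivedPoint) →
              2 ^ (2 * (M₀ - sigmaShift W Dt) - 1) ∣ Nat.card (AddCommGroup.primaryComponent (W.baseChange K).sha 2)) :
    ShiftedKolyvaginStructureModTwoWithOnPos Φ Ω := by
  intro W _ _ _ hCM hρ hΩ K _ _ hK hodd h3 hH hsq hsq2 Dt β ι d₁ hy hσ M₀ hdiv hndiv hK1 n d hn hKol hlev hprim
  haveI : IsTotallyComplex K := hK.2
  exact natCard_sha_two_eq_pow_of_allowance (W.baseChange K)
    (hU W hCM hρ hΩ K hK hodd h3 hH hsq hsq2 Dt β ι d₁ hy hσ M₀ hdiv hndiv hK1 n d hn hKol hlev hprim)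
    (hL W hCM hρ hΩ K hK hodd h3 hH hsq hsq2 Dt β ι d₁ hy hσ M₀ hdiv hndiv hK1 n d hn hKol hlev hprim)

/-- **The registered instance**: `stub_sigmaShiftPosDisc`'s statement (`Φ = ⊤`, `Ω = OnDeltaPlusCell`: full `2`-adic image,
`Δ > 0`, `σ ≥ 1`) from its two one-bit-slack halves. [cite: McCallumLMS1991, §5 Thm. 5.4] [cite: SilvermanAEC2009, Thm. X.4.14] -/
theorem sigmaShiftPosDisc_of_halves_allowance
    (hU : ∀ (W : WeierstrassCurve ℚ) [W.IsElliptic] [W.IsGloballyMinimal] [NeZero (W.conductorNorm ℤ)],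
      ¬ W.HasCM → W.HasSurjectiveModNGaloisRep 2 → OnDeltaPlusCell W →
      ∀ (K : Type) [Field K] [NumberField K], IsImaginaryQuadratic K → Odd (NumberField.discr K) →
        NumberField.discr K ≠ -3 → SatisfiesHeegnerHypothesis (W.conductorNorm ℤ) K →
        ¬ IsSquare ((NumberField.discr K : ℚ) * -|W.Δ|) → ¬ IsSquare ((NumberField.discr K : ℚ) * (-(2 * |W.Δ|))) →
        ∀ (Dt : ModularParametrizationData W (W.conductorNorm ℤ)) (β : ℤ) (ι : K →+* ℂ) (d₁ : KolyvaginHeegnerData Dt β ι 1),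
          ¬ IsOfFinAddOrder d₁.derivedPoint → 0 < sigmaShift W Dt →
          ∀ (M₀ : ℕ), (∃ Q : (W.baseChange (ringClassField K ι 1)).toAffine.Point, ((2 ^ M₀ : ℕ) : ℤ) • Q = d₁.derivedPoint) →
            (¬ ∃ Q : (W.baseChange (ringClassField K ι 1)).toAffine.Point, ((2 ^ (M₀ + 1) : ℕ) : ℤ) • Q = d₁.derivedPoint) →
            (∀ (n : ℕ) (d : KolyvaginHeegnerData Dt β ι n) (m : ℕ), Squarefree n →
                (∀ ℓ ∈ n.primeFactors, Zhang2014.IsKolyvaginPrime (W.conductorNorm ℤ) W K 2 ℓ) →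
                (m : ℕ∞) ≤ Zhang2014.levelIndex W 2 n → m ≤ sigmaShift W Dt →
                ∃ Q : (W.baseChange (ringClassField K ι n)).toAffine.Point, ((2 ^ m : ℕ) : ℤ) • Q = d.derivedPoint) →
            ∀ (n : ℕ) (d : KolyvaginHeegnerData Dt β ι n), Squarefree n →
              (∀ ℓ ∈ n.primeFactors, Zhang2014.IsKolyvaginPrime (W.conductorNorm ℤ) W K 2 ℓ ∧ True) →
              ((sigmaShift W Dt + 1 : ℕ) : ℕ∞) ≤ Zhang2014.levelIndex W 2 n →
              (¬ ∃ Q : (W.baseChange (ringClassField K ι n)).toAffine.Point,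
                ((2 ^ (sigmaShift W Dt + 1) : ℕ) : ℤ) • Q = d.derivedPoint) →
              Nat.card (AddCommGroup.primaryComponent (W.baseChange K).sha 2) ∣ 2 ^ (2 * (M₀ - sigmaShift W Dt) + 1))
    (hL : ∀ (W : WeierstrassCurve ℚ) [W.IsElliptic] [W.IsGloballyMinimal] [NeZero (W.conductorNorm ℤ)],
      ¬ W.HasCM → W.HasSurjectiveModNGaloisRep 2 → OnDeltaPlusCell W →
      ∀ (K : Type) [Field K] [NumberField K], IsImaginaryQuadratic K → Odd (NumberField.discr K) →
        NumberField.discr K ≠ -3 → SatisfiesHeegnerHypothesis (W.conductorNorm ℤ) K →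
        ¬ IsSquare ((NumberField.discr K : ℚ) * -|W.Δ|) → ¬ IsSquare ((NumberField.discr K : ℚ) * (-(2 * |W.Δ|))) →
        ∀ (Dt : ModularParametrizationData W (W.conductorNorm ℤ)) (β : ℤ) (ι : K →+* ℂ) (d₁ : KolyvaginHeegnerData Dt β ι 1),
          ¬ IsOfFinAddOrder d₁.derivedPoint → 0 < sigmaShift W Dt →
          ∀ (M₀ : ℕ), (∃ Q : (W.baseChange (ringClassField K ι 1)).toAffine.Point, ((2 ^ M₀ : ℕ) : ℤ) • Q = d₁.derivedPoint) →
            (¬ ∃ Q : (W.baseChange (ringClassField K ι 1)).toAffine.Point, ((2 ^ (M₀ + 1) : ℕ) : ℤ) • Q = d₁.derivedPoint) →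
            (∀ (n : ℕ) (d : KolyvaginHeegnerData Dt β ι n) (m : ℕ), Squarefree n →
                (∀ ℓ ∈ n.primeFactors, Zhang2014.IsKolyvaginPrime (W.conductorNorm ℤ) W K 2 ℓ) →
                (m : ℕ∞) ≤ Zhang2014.levelIndex W 2 n → m ≤ sigmaShift W Dt →
                ∃ Q : (W.baseChange (ringClassField K ι n)).toAffine.Point, ((2 ^ m : ℕ) : ℤ) • Q = d.derivedPoint) →
            ∀ (n : ℕ) (d : KolyvaginHeegnerData Dt β ι n), Squarefree n →
              (∀ ℓ ∈ n.primeFactors, Zhang2014.IsKolyvaginPrime (W.conductorNorm ℤ) W K 2 ℓ ∧ True) →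
              ((sigmaShift W Dt + 1 : ℕ) : ℕ∞) ≤ Zhang2014.levelIndex W 2 n →
              (¬ ∃ Q : (W.baseChange (ringClassField K ι n)).toAffine.Point,
                ((2 ^ (sigmaShift W Dt + 1) : ℕ) : ℤ) • Q = d.derivedPoint) →
              2 ^ (2 * (M₀ - sigmaShift W Dt) - 1) ∣ Nat.card (AddCommGroup.primaryComponent (W.baseChange K).sha 2)) :
    ShiftedKolyvaginStructureModTwoWithOnPos (fun _ _ => True) OnDeltaPlusCell :=
  shiftedStructureWithOnPos_of_halves_allowance (fun _ _ => True) OnDeltaPlusCell hU hL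

end Summit.BirchSwinnertonDyer.BirchSwinnertonDyer.Theorems.OffBigImageOddLocalAtTwo.FirstRung

end
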